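import Summits.Ventures.YMGap.RobustBall.LoopActionGaugeBall
import Summits.Ventures.YMGap.RobustBall.ShapeLoopFamilyFR
import Summits.Ventures.YMGap.RobustBall.MassGapOnBallZdGRows
import Summits.Ventures.YMGap.RobustBall.MassGapOnBallZdGRowsSUN
import HarnessLib

/-!
# Venture YMGap, track ROBUST-BALL (tier 1) — finite-range loop actions through the ROBUST VERTEX-STAR DOOR: cells up to
# `β_W = 3/10` (`SU(2)`) and HYPOTHESIS-FREE `SU(3)` cells

HONEST FRAMING. WHAT THIS IS: a venture file (cell `pub-ymgap`, track Y2 ROBUST-BALL, seat rb-p1): ds-2's star-door cells on the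
gauge-invariant ball (`MassGapOnBallZdGRows.lean`, `MassGapOnBallZdGRowsSUN.lean`: `MassGapOnBallZdG 4 N (β_W/N²) ε₀ ε₁ R`, class K,
hypothesis-free, every range `R : ℕ`) read on FINITE-RANGE generic Wilson-type loop actions through `memBallZdG_loopFamilyAction`
(`LoopActionGaugeBall.lean`; loads `(2ε, 4ε)` on `ℤ⁴`). The star door reaches further in the coupling than the pair doors, at smaller
radius: `SU(2)`, `d = 4`, finite carrier fibres, finitely many loops per link, extent `≤ R`, unweighted norm `‖c‖₀ ≤ ε` ⇒ unique DLR state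
with exponential clustering for `(β_W, ε) = (1/8, .037), (1/6, .028), (1/5, .02175), (1/4, .01375), (3/10, .007)`; `SU(3)`, `d = 4`,
HYPOTHESIS-FREE: `(1/8, .037), (1/6, .026), (1/5, .01725), (1/4, .00475)`; instances: all closed trails of length `≤ L₀`, finitely many
shapes (`∑_s |c₀ s| |σ s|² ≤ ε`). WHAT IT IS NOT: no new door or number (radii = ds-2's cells ÷ the loop loads); strong-coupling lattice
statements; nothing about the continuum limit or the Clay problem.

References: ds-2 `RobustStarDoorZd.lean`, `MassGapOnBallZdGRows.lean`, `MassGapOnBallZdGRowsSUN.lean`; this track's `LoopActionGaugeBall.lean`,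
`LoopActionFiniteRange.lean`, `ShapeLoopFamilyFR.lean`.
-/

noncomputable section

open MeasureTheory Function Real SimpleGraph
open Literature.Probability.LatticeModels
open Literature.MathematicalPhysics.QuantumLattice
open Literature.MathematicalPhysics.QuantumFieldTheory (walkEdges)

namespace Summit.Ventures.YMGap.RobustBall

variable {ι : Type*} {γ : ι → ZdLoop 4} {c : ι → ℝ} {R : ℕ}

/-! ### `SU(2)`, `d = 4`: generic finite-range loop actions through the star door -/

/-- **`SU(2)`, `β_W = 1/8` (slot `1/32`), star door**: `‖c‖₀ ≤ 0.037` (cell `su2_massGapOnBallZdG_star_oneEighth`). -/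
theorem su2_loopFamilyStar_massGapS_1_8 (hfin : ∀ X, {i | walkEdges (γ i).walk = X}.Finite)
    (hthr : ∀ e : ZdEdge 4, {i | e ∈ walkEdges (γ i).walk}.Finite)
    (hR : ∀ i, ∀ e ∈ walkEdges (γ i).walk, ∀ y ∈ walkEdges (γ i).walk, ‖e.1 - y.1‖ ≤ (R : ℝ))
    (h : LoopNormLE 0 γ c (37 / 1000)) : PerturbedMassGapAtS 4 2 (1 / 32) (loopFamilyAction (d := 4) 2 γ c) :=
  perturbedMassGapAtS_loopFamilyAction_of_gaugeBall (ε := 37 / 1000)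
    ((su2_massGapOnBallZdG_star_oneEighth R).mono (by norm_num) (by norm_num) le_rfl) hfin hthr hR h

/-- **`SU(2)`, `β_W = 1/6` (slot `1/24`), star door**: `‖c‖₀ ≤ 0.028`. -/
theorem su2_loopFamilyStar_massGapS_1_6 (hfin : ∀ X, {i | walkEdges (γ i).walk = X}.Finite)
    (hthr : ∀ e : ZdEdge 4, {i | e ∈ walkEdges (γ i).walk}.Finite)
    (hR : ∀ i, ∀ e ∈ walkEdges (γ i).walk, ∀ y ∈ walkEdges (γ i).walk, ‖e.1 - y.1‖ ≤ (R : ℝ))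
    (h : LoopNormLE 0 γ c (7 / 250)) : PerturbedMassGapAtS 4 2 (1 / 24) (loopFamilyAction (d := 4) 2 γ c) :=
  perturbedMassGapAtS_loopFamilyAction_of_gaugeBall (ε := 7 / 250)
    ((su2_massGapOnBallZdG_star_oneSixth R).mono (by norm_num) (by norm_num) le_rfl) hfin hthr hR h

/-- **`SU(2)`, `β_W = 1/5` (slot `1/20`), star door**: `‖c‖₀ ≤ 0.02175`. -/
theorem su2_loopFamilyStar_massGapS_1_5 (hfin : ∀ X, {i | walkEdges (γ i).walk = X}.Finite)
    (hthr : ∀ e : ZdEdge 4, {i | e ∈ walkEdges (γ i).walk}.Finite)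
    (hR : ∀ i, ∀ e ∈ walkEdges (γ i).walk, ∀ y ∈ walkEdges (γ i).walk, ‖e.1 - y.1‖ ≤ (R : ℝ))
    (h : LoopNormLE 0 γ c (87 / 4000)) : PerturbedMassGapAtS 4 2 (1 / 20) (loopFamilyAction (d := 4) 2 γ c) :=
  perturbedMassGapAtS_loopFamilyAction_of_gaugeBall (ε := 87 / 4000)
    ((su2_massGapOnBallZdG_star_oneFifth R).mono (by norm_num) (by norm_num) le_rfl) hfin hthr hR h

/-- **`SU(2)`, `β_W = 1/4` (slot `1/16`), star door**: `‖c‖₀ ≤ 0.01375`. -/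
theorem su2_loopFamilyStar_massGapS_1_4 (hfin : ∀ X, {i | walkEdges (γ i).walk = X}.Finite)
    (hthr : ∀ e : ZdEdge 4, {i | e ∈ walkEdges (γ i).walk}.Finite)
    (hR : ∀ i, ∀ e ∈ walkEdges (γ i).walk, ∀ y ∈ walkEdges (γ i).walk, ‖e.1 - y.1‖ ≤ (R : ℝ))
    (h : LoopNormLE 0 γ c (11 / 800)) : PerturbedMassGapAtS 4 2 (1 / 16) (loopFamilyAction (d := 4) 2 γ c) :=
  perturbedMassGapAtS_loopFamilyAction_of_gaugeBall (ε := 11 / 800)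
    ((su2_massGapOnBallZdG_star_oneQuarter R).mono (by norm_num) (by norm_num) le_rfl) hfin hthr hR h

/-- **`SU(2)`, `β_W = 3/10` (slot `3/40`), star door**: `‖c‖₀ ≤ 0.007` — the furthest coupling at which a loop-action ball is certified. -/
theorem su2_loopFamilyStar_massGapS_3_10 (hfin : ∀ X, {i | walkEdges (γ i).walk = X}.Finite)
    (hthr : ∀ e : ZdEdge 4, {i | e ∈ walkEdges (γ i).walk}.Finite)
    (hR : ∀ i, ∀ e ∈ walkEdges (γ i).walk, ∀ y ∈ walkEdges (γ i).walk, ‖e.1 - y.1‖ ≤ (R : ℝ))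
    (h : LoopNormLE 0 γ c (7 / 1000)) : PerturbedMassGapAtS 4 2 (3 / 40) (loopFamilyAction (d := 4) 2 γ c) :=
  perturbedMassGapAtS_loopFamilyAction_of_gaugeBall (ε := 7 / 1000)
    ((su2_massGapOnBallZdG_star_threeTenths R).mono (by norm_num) (by norm_num) le_rfl) hfin hthr hR h

/-! ### `SU(3)`, `d = 4`, HYPOTHESIS-FREE (star door on p2's eigen modulus) -/

section SU3

variable {γ₃ : ι → ZdLoop 4} {c₃ : ι → ℝ}

/-- **`SU(3)`, `β_W = 1/8` (slot `1/72`), star door, hypothesis-free**: `‖c‖₀ ≤ 0.037`. -/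
theorem su3_loopFamilyStar_massGapS_1_8 (hfin : ∀ X, {i | walkEdges (γ₃ i).walk = X}.Finite)
    (hthr : ∀ e : ZdEdge 4, {i | e ∈ walkEdges (γ₃ i).walk}.Finite)
    (hR : ∀ i, ∀ e ∈ walkEdges (γ₃ i).walk, ∀ y ∈ walkEdges (γ₃ i).walk, ‖e.1 - y.1‖ ≤ (R : ℝ))
    (h : LoopNormLE 0 γ₃ c₃ (37 / 1000)) : PerturbedMassGapAtS 4 3 (1 / 72) (loopFamilyAction (d := 4) 3 γ₃ c₃) :=
  perturbedMassGapAtS_loopFamilyAction_of_gaugeBall (ε := 37 / 1000)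
    ((su3_massGapOnBallZdG_star_oneEighth R).mono (by norm_num) (by norm_num) le_rfl) hfin hthr hR h

/-- **`SU(3)`, `β_W = 1/6` (slot `1/54`), star door, hypothesis-free**: `‖c‖₀ ≤ 0.026`. -/
theorem su3_loopFamilyStar_massGapS_1_6 (hfin : ∀ X, {i | walkEdges (γ₃ i).walk = X}.Finite)
    (hthr : ∀ e : ZdEdge 4, {i | e ∈ walkEdges (γ₃ i).walk}.Finite)
    (hR : ∀ i, ∀ e ∈ walkEdges (γ₃ i).walk, ∀ y ∈ walkEdges (γ₃ i).walk, ‖e.1 - y.1‖ ≤ (R : ℝ))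
    (h : LoopNormLE 0 γ₃ c₃ (13 / 500)) : PerturbedMassGapAtS 4 3 (1 / 54) (loopFamilyAction (d := 4) 3 γ₃ c₃) :=
  perturbedMassGapAtS_loopFamilyAction_of_gaugeBall (ε := 13 / 500)
    ((su3_massGapOnBallZdG_star_oneSixth R).mono (by norm_num) (by norm_num) le_rfl) hfin hthr hR h

/-- **`SU(3)`, `β_W = 1/5` (slot `1/45`), star door, hypothesis-free**: `‖c‖₀ ≤ 0.01725`. -/
theorem su3_loopFamilyStar_massGapS_1_5 (hfin : ∀ X, {i | walkEdges (γ₃ i).walk = X}.Finite)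
    (hthr : ∀ e : ZdEdge 4, {i | e ∈ walkEdges (γ₃ i).walk}.Finite)
    (hR : ∀ i, ∀ e ∈ walkEdges (γ₃ i).walk, ∀ y ∈ walkEdges (γ₃ i).walk, ‖e.1 - y.1‖ ≤ (R : ℝ))
    (h : LoopNormLE 0 γ₃ c₃ (69 / 4000)) : PerturbedMassGapAtS 4 3 (1 / 45) (loopFamilyAction (d := 4) 3 γ₃ c₃) :=
  perturbedMassGapAtS_loopFamilyAction_of_gaugeBall (ε := 69 / 4000)
    ((su3_massGapOnBallZdG_star_oneFifth R).mono (by norm_num) (by norm_num) le_rfl) hfin hthr hR h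

/-- **`SU(3)`, `β_W = 1/4` (slot `1/36`), star door, hypothesis-free**: `‖c‖₀ ≤ 0.00475`. -/
theorem su3_loopFamilyStar_massGapS_1_4 (hfin : ∀ X, {i | walkEdges (γ₃ i).walk = X}.Finite)
    (hthr : ∀ e : ZdEdge 4, {i | e ∈ walkEdges (γ₃ i).walk}.Finite)
    (hR : ∀ i, ∀ e ∈ walkEdges (γ₃ i).walk, ∀ y ∈ walkEdges (γ₃ i).walk, ‖e.1 - y.1‖ ≤ (R : ℝ))
    (h : LoopNormLE 0 γ₃ c₃ (19 / 4000)) : PerturbedMassGapAtS 4 3 (1 / 36) (loopFamilyAction (d := 4) 3 γ₃ c₃) :=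
  perturbedMassGapAtS_loopFamilyAction_of_gaugeBall (ε := 19 / 4000)
    ((su3_massGapOnBallZdG_star_oneQuarter R).mono (by norm_num) (by norm_num) le_rfl) hfin hthr hR h

end SU3

/-! ### Instances: all closed trails of bounded length; finitely many shapes -/

/-- **`SU(2)`, `β_W = 1/5` — all closed trails of length `≤ L₀` with `∑_{γ ∋ e} |c_γ| |γ| ≤ 0.02175`** (star door, range `2L₀`). -/
theorem su2_trailsLEStar_massGapS_1_5 (L₀ : ℕ) {c : TrailIdxLE 4 L₀ → ℝ} (h : LoopNormLE 0 (trailLoopLE L₀) c (87 / 4000)) :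
    PerturbedMassGapAtS 4 2 (1 / 20) (loopFamilyAction (d := 4) 2 (trailLoopLE L₀) c) :=
  su2_loopFamilyStar_massGapS_1_5 (R := 2 * L₀) finite_fibre_trailLoopLE finite_through_trailLoopLE
    (fun i e he y hy => by exact_mod_cast norm_sub_le_trailLoopLE i e he y hy) h

/-- **`SU(2)`, `β_W = 1/4` — all closed trails of length `≤ L₀` with `‖c‖₀ ≤ 0.01375`.** -/
theorem su2_trailsLEStar_massGapS_1_4 (L₀ : ℕ) {c : TrailIdxLE 4 L₀ → ℝ} (h : LoopNormLE 0 (trailLoopLE L₀) c (11 / 800)) :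
    PerturbedMassGapAtS 4 2 (1 / 16) (loopFamilyAction (d := 4) 2 (trailLoopLE L₀) c) :=
  su2_loopFamilyStar_massGapS_1_4 (R := 2 * L₀) finite_fibre_trailLoopLE finite_through_trailLoopLE
    (fun i e he y hy => by exact_mod_cast norm_sub_le_trailLoopLE i e he y hy) h

/-- **`SU(3)`, `β_W = 1/5`, hypothesis-free — all closed trails of length `≤ L₀` with `‖c‖₀ ≤ 0.01725`.** -/
theorem su3_trailsLEStar_massGapS_1_5 (L₀ : ℕ) {c : TrailIdxLE 4 L₀ → ℝ} (h : LoopNormLE 0 (trailLoopLE L₀) c (69 / 4000)) :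
    PerturbedMassGapAtS 4 3 (1 / 45) (loopFamilyAction (d := 4) 3 (trailLoopLE L₀) c) :=
  su3_loopFamilyStar_massGapS_1_5 (R := 2 * L₀) finite_fibre_trailLoopLE finite_through_trailLoopLE
    (fun i e he y hy => by exact_mod_cast norm_sub_le_trailLoopLE i e he y hy) h

/-- **`SU(2)`, `β_W = 1/5` — any FINITE set of loop shapes translated everywhere with `∑_s |c₀ s| |σ s|² ≤ 0.02175`** (shapes of
extent `≤ R`). -/
theorem su2_finiteShapesStar_massGapS_1_5 {S : Type*} [Fintype S] {σ : S → (zdGraph 4).Walk (0 : Site 4) 0}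
    (hpos : ∀ s, 0 < (σ s).length) (hRσ : ∀ s, ∀ e ∈ walkEdges (σ s), ∀ y ∈ walkEdges (σ s), ‖e.1 - y.1‖ ≤ (R : ℝ))
    {c₀ : S → ℝ} (hε : ∑ s, |c₀ s| * ((σ s).length : ℝ) ^ 2 ≤ 87 / 4000) :
    PerturbedMassGapAtS 4 2 (1 / 20) (loopFamilyAction (d := 4) 2 (shapeLoop σ) fun i => c₀ i.2) := by
  have hR' : ∀ i : Site 4 × S, ∀ e ∈ walkEdges (shapeLoop σ i).walk, ∀ y ∈ walkEdges (shapeLoop σ i).walk,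
      ‖e.1 - y.1‖ ≤ (R : ℝ) := by
    intro i e he y hy
    have h := hRσ i.2 _ ((mem_walkEdges_shapeLoop_iff σ i e).1 he) _ ((mem_walkEdges_shapeLoop_iff σ i y).1 hy)
    simpa [sub_sub_sub_cancel_right] using h
  have hn : LoopNormLE 0 (shapeLoop σ) (fun i => c₀ i.2) (87 / 4000) := loopNormLE_zero_shapeLoop hRσ hε
  exact su2_loopFamilyStar_massGapS_1_5 (finite_fibre_shapeLoop σ finite_fibre_of_finite_shapes hpos)
    (finite_through_shapeLoop σ) hR' hn

/-- **`SU(3)`, `β_W = 1/5`, hypothesis-free — any finite set of loop shapes with `∑_s |c₀ s| |σ s|² ≤ 0.01725`.** -/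
theorem su3_finiteShapesStar_massGapS_1_5 {S : Type*} [Fintype S] {σ : S → (zdGraph 4).Walk (0 : Site 4) 0}
    (hpos : ∀ s, 0 < (σ s).length) (hRσ : ∀ s, ∀ e ∈ walkEdges (σ s), ∀ y ∈ walkEdges (σ s), ‖e.1 - y.1‖ ≤ (R : ℝ))
    {c₀ : S → ℝ} (hε : ∑ s, |c₀ s| * ((σ s).length : ℝ) ^ 2 ≤ 69 / 4000) :
    PerturbedMassGapAtS 4 3 (1 / 45) (loopFamilyAction (d := 4) 3 (shapeLoop σ) fun i => c₀ i.2) := by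
  have hR' : ∀ i : Site 4 × S, ∀ e ∈ walkEdges (shapeLoop σ i).walk, ∀ y ∈ walkEdges (shapeLoop σ i).walk,
      ‖e.1 - y.1‖ ≤ (R : ℝ) := by
    intro i e he y hy
    have h := hRσ i.2 _ ((mem_walkEdges_shapeLoop_iff σ i e).1 he) _ ((mem_walkEdges_shapeLoop_iff σ i y).1 hy)
    simpa [sub_sub_sub_cancel_right] using h
  have hn : LoopNormLE 0 (shapeLoop σ) (fun i => c₀ i.2) (69 / 4000) := loopNormLE_zero_shapeLoop hRσ hε
  exact su3_loopFamilyStar_massGapS_1_5 (finite_fibre_shapeLoop σ finite_fibre_of_finite_shapes hpos)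
    (finite_through_shapeLoop σ) hR' hn

end Summit.Ventures.YMGap.RobustBall

end
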